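import Literature.AlgebraicGeometry.HodgeTheory.AbelianVarietyEndAlgebraReducedIffEndReduced
import Literature.AlgebraicGeometry.HodgeTheory.AbelianVarietyIsotypicCentralIdempotents
import HarnessLib

/-!
# Idempotents of `End⁰(X)` versus abelian subvarieties of `X`: an abelian variety has finitely many abelian subvarieties
# iff `End⁰(X)` has finitely many idempotents iff every idempotent of `End⁰(X)` is central, and then both numbers are `2^r`
# (Mumford §19 Cor. 1–2; Lam FC Ex. 12.7, (21.5), (22.1); Zarhin 2008 Thm. 3.2)

Layer `Literature/AlgebraicGeometry/HodgeTheory`; theorems only (no `def`, no instance, no named fact; net debt 0).  In the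
Wedderburn decomposition `End⁰ X = ⊕_i M_{n_i}(D_i)` (Mumford §19 Cor. 2) an idempotent is central iff it is a sum of block
units, and there are `2^r` of those (`HodgeTheory/AbelianVarietyIsotypicCentralIdempotents`: `r` = number of isotypic components);
NON-central idempotents exist iff some `n_i ≥ 2`, and then there are infinitely many (`e_{11} + t e_{12}`, `t ∈ ℚ`).  Since
«finitely many abelian subvarieties ⟺ all `n_i = 1` ⟺ `End⁰ X` reduced» (`…SubvarietiesFiniteIffMultiplicityFree`,
`…EndAlgebraReducedIffEndReduced`) and idempotents of a reduced ring are central (Lam, Ex. 12.7), the lattice of abelian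
subvarieties is finite iff the set of idempotents of `End⁰ X` is, and both then have `2^r` elements.

§0 is pure ring theory (a reduced ring has only central idempotents).  §1 holds over ANY field: from the integral matrix units
`a_l : X → B`, `b_k : B → X` of a repeated factor (`…CommutativeEndSubvarieties.exists_matrixUnits_of_component`) the elements
`P = M⁻¹ ⊗ (a_{k₀} ≫ b_{k₀})`, `W = 1 ⊗ (a_{k₀} ≫ b_{k₁})` of `End⁰ X` satisfy `P² = P`, `W P = W`, `P W = W² = 0`, `W ≠ 0`, so
`ε_t = P + t W` (`t ∈ ℚ`) are pairwise distinct idempotents and `P W = 0 ≠ W = W P`; for `B ⊞ B` the idempotents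
`fst ≫ inl + n • (snd ≫ inl)` already live in the order `End(B ⊞ B)`.  §2 is over a PERFECT field (isotypic components exist).

THE PRINT.  Mumford, *Abelian Varieties* (1970) §19 Cor. 1–2 of Thm. 1 (pp. 173–174: `X ∼ ∏ X_i^{n_i}`,
`End⁰ X = ⊕ M_{n_i}(D_i)`); Lam, *A First Course in Noncommutative Rings* (2nd ed.) §12 Ex. 12.7 (PDF p. 206: «any idempotent
`e` in a reduced ring is central»), §21 Lemma (21.5) (p. 308: `e` central iff `eRf = fRe = 0`, the tree's
`RingTheory/Idempotents/CentralIdempotents.forall_comm_iff_corner_eq_zero`), §22 Prop. (22.1) (p. 326: `2^r` central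
idempotents); Zarhin 2008 Thm. 3.2 (p. 7; Lenstra–Oort–Zarhin 1996) for the finiteness of abelian subvarieties.

Results (namespace `Literature.AlgebraicGeometry.HodgeTheory.AbelianVariety`):
* §0 (rings) `mul_mul_one_sub_eq_zero_of_isIdempotentElem_of_isReduced`, **`forall_comm_of_isIdempotentElem_of_isReduced`**,
  `setOf_isIdempotentElem_eq_setOf_central_of_isReduced`, `isIdempotentElem_add_smul_of_relations`,
  `infinite_setOf_isIdempotentElem_of_relations` (a matrix-unit pair `P² = P`, `W P = W`, `P W = W² = 0`, `W ≠ 0` in a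
  `ℚ`-algebra gives the pairwise distinct idempotents `P + t W`);
* §1 (any field) **`exists_endAlgebra_matrixUnit_pair_of_component`**, **`exists_isIdempotentElem_endAlgebra_not_comm_of_component`**,
  **`infinite_setOf_isIdempotentElem_endAlgebra_of_component`**, `isIdempotentElem_fst_inl_add_nsmul_snd_inl`,
  **`infinite_setOf_isIdempotentElem_end_biprod_self`** (the ORDER `End(B ⊞ B)` has infinitely many idempotents),
  `exists_isIdempotentElem_end_not_comm_biprod_self`, `infinite_setOf_isIdempotentElem_endAlgebra_biprod_self`,
  `forall_comm_of_isIdempotentElem_endAlgebra_of_isSimple_components`,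
  **`ncard_setOf_isIdempotentElem_endAlgebra_of_isSimple_components`** (multiplicity-free system: exactly `2^{#Q}` idempotents),
  **`ncard_setOf_isIdempotentElem_endAlgebra_of_isSimple`** (simple `X` of positive dimension: exactly `2`);
* §2 (perfect field) **`forall_isIdempotentElem_endAlgebra_comm_iff_finite_setOf_range_subvariety`**,
  **`finite_setOf_isIdempotentElem_endAlgebra_iff_finite_setOf_range_subvariety`**,
  `finite_setOf_isIdempotentElem_endAlgebra_iff_isReduced_endAlgebra`,
  **`natCard_setOf_isIdempotentElem_endAlgebra_eq_natCard_setOf_range_subvariety`** («an abelian variety has as many abelian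
  subvarieties as its endomorphism algebra has idempotents», `Nat.card`), `natCard_setOf_isIdempotentElem_endAlgebra_eq_two_pow`.

## References
* [MumfordAV1970] D. Mumford, *Abelian Varieties* (1970), §19 Thm. 1, Cor. 1–2, Thm. 3 (pp. 173–176).
* [Lam2001FirstCourse] T. Y. Lam, *A First Course in Noncommutative Rings*, 2nd ed., GTM 131 (2001), §12 Ex. 12.7 (PDF p. 206),
  §21 Lemma (21.5) p. 308, §22 Prop. (22.1) p. 326.
* [Zarhin2008HomomorphismsFiniteFields] Yu. G. Zarhin, *Homomorphisms of abelian varieties over finite fields* (2008)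
  (arXiv:0711.1615), Thm. 3.2 (p. 7).
* [Milne1986AbelianVarieties] J. S. Milne, *Abelian Varieties*, in Cornell–Silverman (1986), §12 p. 122 (PDF p. 189).
-/

noncomputable section

universe u

open CategoryTheory CategoryTheory.Limits

namespace Literature.AlgebraicGeometry.HodgeTheory

namespace AbelianVariety

open _root_.AlgebraicGeometry
open Literature.AlgebraicGeometry.Motives Literature.AlgebraicGeometry.Motives.AbelianVariety

/-! ## §0 In a reduced ring every idempotent is central (Lam, Ex. 12.7) -/

section Ring

variable {R : Type*} [Ring R]

/-- In a reduced ring, `e a (1 - e) = 0` for an idempotent `e` (its square `e a (1-e) e a (1-e)` vanishes because `(1-e) e = 0`).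
[cite: Lam2001FirstCourse, §12 Ex. 12.7 (PDF p. 206) and §21 Lemma (21.5) p. 308] -/
theorem mul_mul_one_sub_eq_zero_of_isIdempotentElem_of_isReduced [IsReduced R] {e : R} (he : IsIdempotentElem e) (a : R) :
    e * a * (1 - e) = 0 := by
  refine IsReduced.eq_zero _ ⟨2, ?_⟩
  rw [pow_two, ← mul_assoc, mul_assoc (e * a) (1 - e) (e * a), ← mul_assoc (1 - e) e a, he.one_sub_mul_self, zero_mul,
    mul_zero, zero_mul]

/-- **IN A REDUCED RING EVERY IDEMPOTENT IS CENTRAL** (Lam, Ex. 12.7: `eRf = fRe = 0` with `f = 1 - e`, then (21.5)).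
[cite: Lam2001FirstCourse, §12 Ex. 12.7 (PDF p. 206) and §21 Lemma (21.5) p. 308] -/
theorem forall_comm_of_isIdempotentElem_of_isReduced [IsReduced R] {e : R} (he : IsIdempotentElem e) (a : R) :
    e * a = a * e := by
  refine (Literature.RingTheory.Idempotents.forall_comm_iff_corner_eq_zero he).2 (fun b ↦ ⟨?_, ?_⟩) a
  · exact mul_mul_one_sub_eq_zero_of_isIdempotentElem_of_isReduced he b
  · have h := mul_mul_one_sub_eq_zero_of_isIdempotentElem_of_isReduced he.one_sub b
    rwa [sub_sub_cancel] at h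

/-- In a reduced ring the idempotents are exactly the central idempotents. [cite: Lam2001FirstCourse, §12 Ex. 12.7 (PDF p. 206)] -/
theorem setOf_isIdempotentElem_eq_setOf_central_of_isReduced [IsReduced R] :
    {e : R | IsIdempotentElem e} = {e : R | IsIdempotentElem e ∧ ∀ a, e * a = a * e} :=
  Set.ext fun _ ↦ ⟨fun he ↦ ⟨he, forall_comm_of_isIdempotentElem_of_isReduced he⟩, fun he ↦ he.1⟩

/-- The idempotents `P + t W` of a `ℚ`-algebra built from a matrix-unit pair: `P² = P`, `W P = W`, `P W = 0`, `W² = 0`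
(`P = e₁₁`, `W = e₂₁` in `M_2(D)`). [cite: MumfordAV1970, §19 Cor. 2 of Thm. 1 (p. 174: `M_n(D)`, `n ≥ 2`)] -/
theorem isIdempotentElem_add_smul_of_relations {E : Type*} [Ring E] [Algebra ℚ E] {P W : E} (hPP : P * P = P)
    (hWP : W * P = W) (hPW : P * W = 0) (hWW : W * W = 0) (t : ℚ) : IsIdempotentElem (P + t • W) := by
  change (P + t • W) * (P + t • W) = P + t • W
  simp only [mul_add, add_mul, smul_mul_assoc, mul_smul_comm, hPP, hWP, hPW, hWW, smul_zero, add_zero]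

/-- `t ↦ P + t W` is injective for `W ≠ 0` in a `ℚ`-algebra (plumbing). [folklore] -/
private theorem injective_const_add_smul_of_ne_zero {E : Type*} [Ring E] [Algebra ℚ E] (P : E) {W : E} (hW : W ≠ 0) :
    Function.Injective fun t : ℚ ↦ P + t • W := fun _ _ h ↦
  smul_left_injective ℚ hW (add_left_cancel h)

/-- Such a pair gives infinitely many idempotents and a non-central one (`P W = 0 ≠ W = W P`). [cite: Lam2001FirstCourse, §21 Lemma (21.5) p. 308] -/
theorem infinite_setOf_isIdempotentElem_of_relations {E : Type*} [Ring E] [Algebra ℚ E] {P W : E} (hPP : P * P = P)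
    (hWP : W * P = W) (hPW : P * W = 0) (hWW : W * W = 0) (hW : W ≠ 0) : {ε : E | IsIdempotentElem ε}.Infinite :=
  Set.infinite_of_injective_forall_mem (injective_const_add_smul_of_ne_zero P hW) fun t ↦ isIdempotentElem_add_smul_of_relations hPP hWP hPW hWW t

end Ring

variable {K : Type u} [Field K]

/-! ## §1 Non-central idempotents from a repeated factor (any field) -/

section AnyField

variable {X : Motives.AbelianVariety K} {Q : Type} [Fintype Q] {Y : Q → Motives.AbelianVariety K}

/-- **A MATRIX-UNIT PAIR IN `End⁰ X` FROM A REPEATED FACTOR** (any field): if a member `Y_q ∼ B^ι` of a family of abelian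
subvarieties `i_q : Y_q ↪ X` with `⨁ Y_q → X` an isogeny has two indices `k₀ ≠ k₁` and `0 < dim B`, then
`P = M⁻¹ ⊗ (a_{k₀} ≫ b_{k₀})`, `W = 1 ⊗ (a_{k₀} ≫ b_{k₁})` satisfy `P² = P`, `W P = W`, `P W = 0`, `W² = 0`, `W ≠ 0`
(`a_l`, `b_k` the integral matrix units of `…CommutativeEndSubvarieties.exists_matrixUnits_of_component`).
[cite: MumfordAV1970, §19 Cor. 2 of Thm. 1 (p. 174) and Remark p. 169] [cite: Milne1986AbelianVarieties, §12 p. 122 (PDF p. 189)] -/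
theorem exists_endAlgebra_matrixUnit_pair_of_component (i : ∀ q, Y q ⟶ X)
    (hi : ∀ q, IsClosedImmersion (Hom.toSchemeHom (i q))) (hdesc : IsIsogeny (biproduct.desc i)) {q : Q}
    {B : Motives.AbelianVariety K} {ι : Type} [Fintype ι] (hY : IsIsogenous (Y q) (⨁ fun _ : ι ↦ B)) {k₀ k₁ : ι}
    (hk : k₀ ≠ k₁) (hB : 0 < B.dim) :
    ∃ P W : X.endAlgebra, P * P = P ∧ W * P = W ∧ P * W = 0 ∧ W * W = 0 ∧ W ≠ 0 := by
  obtain ⟨a, b, M, hM, hbf, hdiag, hoff⟩ := exists_matrixUnits_of_component i hi hdesc hY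
  have hinj := endAlgebra.of_injective_of_isIsogeny_zsmul_id (isIsogeny_zsmul_id_holds X)
  set U : X.endAlgebra := endAlgebra.of X (End.of (a k₀ ≫ b k₀)) with hU
  set W : X.endAlgebra := endAlgebra.of X (End.of (a k₀ ≫ b k₁)) with hW
  have hM' : (M : ℚ) ≠ 0 := Nat.cast_ne_zero.2 hM
  have hrel : ∀ k, (a k₀ ≫ b k₀) ≫ a k₀ ≫ b k = M • (a k₀ ≫ b k) := fun k ↦ by
    rw [Category.assoc, ← Category.assoc (b k₀) (a k₀), hdiag k₀, Preadditive.nsmul_comp, Category.id_comp,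
      Preadditive.comp_nsmul]
  have hrel' : ∀ k, (a k₀ ≫ b k₁) ≫ a k₀ ≫ b k = 0 := fun k ↦ by
    rw [Category.assoc, ← Category.assoc (b k₁) (a k₀), hoff k₁ k₀ hk.symm, zero_comp, comp_zero]
  have hUU : U * U = (M : ℚ) • U := by
    rw [Nat.cast_smul_eq_nsmul, hU, ← map_nsmul, ← map_mul]
    exact congrArg (endAlgebra.of X) (by rw [End.mul_def]; exact hrel k₀)
  have hWU : W * U = (M : ℚ) • W := by
    rw [Nat.cast_smul_eq_nsmul, hU, hW, ← map_nsmul, ← map_mul]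
    exact congrArg (endAlgebra.of X) (by rw [End.mul_def]; exact hrel k₁)
  have hUW : U * W = 0 := by
    rw [hU, hW, ← map_mul]
    exact (congrArg (endAlgebra.of X) (by rw [End.mul_def]; exact hrel' k₀)).trans (map_zero _)
  have hWW : W * W = 0 := by
    rw [hW, ← map_mul]
    exact (congrArg (endAlgebra.of X) (by rw [End.mul_def]; exact hrel' k₁)).trans (map_zero _)
  have hW0 : W ≠ 0 := fun h ↦ by
    have h1 : a k₀ ≫ b k₁ = 0 := hinj (h.trans (map_zero (endAlgebra.of X)).symm)
    have h2 : M • b k₁ = 0 := by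
      rw [← Category.id_comp (b k₁), ← Preadditive.nsmul_comp, ← hdiag k₀, Category.assoc, h1, comp_zero]
    haveI := hbf k₁
    exact ne_zero_of_isFinite (b k₁) hB (hom_eq_zero_of_nsmul_eq_zero hM h2)
  refine ⟨(M : ℚ)⁻¹ • U, W, ?_, ?_, ?_, hWW, hW0⟩
  · simp only [smul_mul_assoc, mul_smul_comm, hUU, smul_smul, inv_mul_cancel₀ hM', one_smul]
  · simp only [mul_smul_comm, hWU, smul_smul, inv_mul_cancel₀ hM', one_smul]
  · rw [smul_mul_assoc, hUW, smul_zero]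

/-- **A REPEATED FACTOR GIVES A NON-CENTRAL IDEMPOTENT OF `End⁰ X`** (any field): `P W = 0 ≠ W = W P`.
[cite: MumfordAV1970, §19 Cor. 2 of Thm. 1 (p. 174)] [cite: Lam2001FirstCourse, §21 Lemma (21.5) p. 308] -/
theorem exists_isIdempotentElem_endAlgebra_not_comm_of_component (i : ∀ q, Y q ⟶ X)
    (hi : ∀ q, IsClosedImmersion (Hom.toSchemeHom (i q))) (hdesc : IsIsogeny (biproduct.desc i)) {q : Q}
    {B : Motives.AbelianVariety K} {ι : Type} [Fintype ι] (hY : IsIsogenous (Y q) (⨁ fun _ : ι ↦ B)) {k₀ k₁ : ι}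
    (hk : k₀ ≠ k₁) (hB : 0 < B.dim) :
    ∃ ε x : X.endAlgebra, IsIdempotentElem ε ∧ ε * x ≠ x * ε := by
  obtain ⟨P, W, hPP, hWP, hPW, -, hW0⟩ := exists_endAlgebra_matrixUnit_pair_of_component i hi hdesc hY hk hB
  refine ⟨P, W, hPP, ?_⟩
  rw [hPW, hWP]
  exact hW0.symm

/-- **A REPEATED FACTOR GIVES INFINITELY MANY IDEMPOTENTS OF `End⁰ X`** (any field): `P + t W`, `t ∈ ℚ`, are pairwise distinct
idempotents. [cite: MumfordAV1970, §19 Cor. 2 of Thm. 1 (p. 174) and Remark p. 169] -/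
theorem infinite_setOf_isIdempotentElem_endAlgebra_of_component (i : ∀ q, Y q ⟶ X)
    (hi : ∀ q, IsClosedImmersion (Hom.toSchemeHom (i q))) (hdesc : IsIsogeny (biproduct.desc i)) {q : Q}
    {B : Motives.AbelianVariety K} {ι : Type} [Fintype ι] (hY : IsIsogenous (Y q) (⨁ fun _ : ι ↦ B)) {k₀ k₁ : ι}
    (hk : k₀ ≠ k₁) (hB : 0 < B.dim) : {ε : X.endAlgebra | IsIdempotentElem ε}.Infinite := by
  obtain ⟨P, W, hPP, hWP, hPW, hWW, hW0⟩ := exists_endAlgebra_matrixUnit_pair_of_component i hi hdesc hY hk hB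
  exact infinite_setOf_isIdempotentElem_of_relations hPP hWP hPW hWW hW0

omit [Fintype Q] in
/-- The idempotents `fst ≫ inl + n • (snd ≫ inl)` of the ORDER `End(B ⊞ B)` (any field, `n ∈ ℕ`).
[cite: MumfordAV1970, §19 Cor. 2 of Thm. 1 (p. 174: `End⁰(B²) = M_2(End⁰ B)`)] -/
theorem isIdempotentElem_fst_inl_add_nsmul_snd_inl (B : Motives.AbelianVariety K) (n : ℕ) :
    IsIdempotentElem (End.of ((biprod.fst : B ⊞ B ⟶ B) ≫ biprod.inl + n • ((biprod.snd : B ⊞ B ⟶ B) ≫ biprod.inl))) := by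
  change End.of _ * End.of _ = End.of _
  rw [End.mul_def]
  change (biprod.fst ≫ biprod.inl + n • (biprod.snd ≫ biprod.inl)) ≫ (biprod.fst ≫ biprod.inl + n • (biprod.snd ≫ biprod.inl)) =
    biprod.fst ≫ biprod.inl + n • (biprod.snd ≫ biprod.inl)
  simp only [Preadditive.add_comp, Preadditive.comp_add, Preadditive.nsmul_comp, Preadditive.comp_nsmul, Category.assoc,
    biprod.inl_fst_assoc, biprod.inl_snd_assoc, zero_comp, comp_zero, smul_zero, add_zero]

omit [Fintype Q] in
/-- **THE ORDER `End(B ⊞ B)` HAS INFINITELY MANY IDEMPOTENTS** for `0 < dim B` (any field; e.g. `E × E` for an elliptic curve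
`E`): `fst ≫ inl + n • (snd ≫ inl)`, `n ∈ ℕ`, are pairwise distinct. [cite: MumfordAV1970, §19 Cor. 2 of Thm. 1 (p. 174) and Thm. 3 (p. 176)] -/
theorem infinite_setOf_isIdempotentElem_end_biprod_self {B : Motives.AbelianVariety K} (hB : 0 < B.dim) :
    {e : End (B ⊞ B) | IsIdempotentElem e}.Infinite := by
  refine Set.infinite_of_injective_forall_mem (f := fun n : ℕ ↦
    End.of ((biprod.fst : B ⊞ B ⟶ B) ≫ biprod.inl + n • ((biprod.snd : B ⊞ B ⟶ B) ≫ biprod.inl))) (fun n m h ↦ ?_)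
    fun n ↦ isIdempotentElem_fst_inl_add_nsmul_snd_inl B n
  have h' : n • ((biprod.snd : B ⊞ B ⟶ B) ≫ biprod.inl) = m • ((biprod.snd : B ⊞ B ⟶ B) ≫ biprod.inl) :=
    add_left_cancel (show End.of _ = End.of _ from h)
  have h'' := congrArg (fun φ ↦ biprod.inr ≫ φ ≫ biprod.fst) h'
  simp only [Preadditive.nsmul_comp, Preadditive.comp_nsmul, Category.assoc, biprod.inl_fst, Category.comp_id,
    biprod.inr_snd] at h''
  exact nsmul_id_injective hB h''

omit [Fintype Q] in
/-- `End(B ⊞ B)` has a non-central idempotent for `0 < dim B` (any field): `e = fst ≫ inl` and `φ = snd ≫ inl` have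
`e * φ = φ ≠ 0 = φ * e`. [cite: MumfordAV1970, §19 Cor. 2 of Thm. 1 (p. 174)] [cite: Lam2001FirstCourse, §21 Lemma (21.5) p. 308] -/
theorem exists_isIdempotentElem_end_not_comm_biprod_self {B : Motives.AbelianVariety K} (hB : 0 < B.dim) :
    ∃ e φ : End (B ⊞ B), IsIdempotentElem e ∧ e * φ ≠ φ * e := by
  refine ⟨End.of ((biprod.fst : B ⊞ B ⟶ B) ≫ biprod.inl), End.of ((biprod.snd : B ⊞ B ⟶ B) ≫ biprod.inl), ?_, fun h ↦ ?_⟩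
  · have h := isIdempotentElem_fst_inl_add_nsmul_snd_inl B 0
    rwa [zero_smul, add_zero] at h
  rw [End.mul_def, End.mul_def] at h
  change (biprod.snd ≫ biprod.inl) ≫ biprod.fst ≫ biprod.inl = (biprod.fst ≫ biprod.inl) ≫ biprod.snd ≫ biprod.inl at h
  simp only [Category.assoc, biprod.inl_fst_assoc, biprod.inl_snd_assoc] at h
  have h' := congrArg (fun φ ↦ biprod.inr ≫ φ ≫ biprod.fst) h
  simp only [Category.assoc, biprod.inl_fst, Category.comp_id, biprod.inr_snd, zero_comp, comp_zero] at h'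
  exact id_ne_zero_of_dim_pos hB h'

omit [Fintype Q] in
/-- `End⁰(B ⊞ B)` has infinitely many idempotents for `0 < dim B` (any field). [cite: MumfordAV1970, §19 Cor. 2 of Thm. 1 (p. 174)] -/
theorem infinite_setOf_isIdempotentElem_endAlgebra_biprod_self {B : Motives.AbelianVariety K} (hB : 0 < B.dim) :
    {ε : (B ⊞ B).endAlgebra | IsIdempotentElem ε}.Infinite := by
  have hinj := endAlgebra.of_injective_of_isIsogeny_zsmul_id (isIsogeny_zsmul_id_holds (B ⊞ B))
  refine ((infinite_setOf_isIdempotentElem_end_biprod_self hB).image hinj.injOn).mono ?_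
  rintro _ ⟨e, he, rfl⟩
  exact IsIdempotentElem.map he _

/-- For a multiplicity-free system (`Hom`-orthogonal SIMPLE `i_q : Y_q ↪ X`, addition map an isogeny) every idempotent of
`End⁰ X` is central (any field; `End⁰ X` is reduced). [cite: MumfordAV1970, §19 Cor. 2 of Thm. 1 (p. 174)] [cite: Lam2001FirstCourse, §12 Ex. 12.7 (PDF p. 206)] -/
theorem forall_comm_of_isIdempotentElem_endAlgebra_of_isSimple_components (i : ∀ q, Y q ⟶ X)
    (hi : ∀ q, IsClosedImmersion (Hom.toSchemeHom (i q))) (hdesc : IsIsogeny (biproduct.desc i))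
    (horth : ∀ q q', q ≠ q' → ∀ f : Y q ⟶ Y q', f = 0) (hYs : ∀ q, (Y q).IsSimple) {ε : X.endAlgebra}
    (hε : IsIdempotentElem ε) (x : X.endAlgebra) : ε * x = x * ε :=
  haveI := isReduced_endAlgebra_of_isSimple_components i hi hdesc horth hYs
  forall_comm_of_isIdempotentElem_of_isReduced hε x

/-- **A MULTIPLICITY-FREE `X` HAS EXACTLY `2^{#Q}` IDEMPOTENTS IN `End⁰ X`, ALL CENTRAL** (any field; `Hom`-orthogonal simple
`i_q : Y_q ↪ X` of positive dimension with `⨁ Y_q → X` an isogeny). [cite: Lam2001FirstCourse, §22 Prop. (22.1) p. 326]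
[cite: MumfordAV1970, §19 Cor. 2 of Thm. 1 (p. 174)] -/
theorem ncard_setOf_isIdempotentElem_endAlgebra_of_isSimple_components (i : ∀ q, Y q ⟶ X)
    (hi : ∀ q, IsClosedImmersion (Hom.toSchemeHom (i q))) (hdesc : IsIsogeny (biproduct.desc i))
    (horth : ∀ q q', q ≠ q' → ∀ f : Y q ⟶ Y q', f = 0) (hYs : ∀ q, (Y q).IsSimple) (hY0 : ∀ q, 0 < (Y q).dim) :
    {ε : X.endAlgebra | IsIdempotentElem ε}.ncard = 2 ^ Fintype.card Q := by
  haveI := isReduced_endAlgebra_of_isSimple_components i hi hdesc horth hYs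
  rw [setOf_isIdempotentElem_eq_setOf_central_of_isReduced]
  exact ncard_setOf_central_idempotent_endAlgebra i hi hdesc horth
    fun q ↦ isSimpleRing_endAlgebra_of_isSimple_of_dim_pos (hYs q) (hY0 q)

omit [Fintype Q] in
/-- **A simple abelian variety of positive dimension has exactly the two idempotents `0`, `1` in `End⁰ X`** (any field; `End⁰ X`
is a division algebra, `ComplexMultiplication/CMTypeOfSimpleSubvariety.endAlgebra_exists_inv_of_isSimple`).
[cite: MumfordAV1970, §19 Cor. 2 of Thm. 1 (p. 174)] [cite: Lam2001FirstCourse, §22 Prop. (22.1) p. 326] -/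
theorem ncard_setOf_isIdempotentElem_endAlgebra_of_isSimple (hX : X.IsSimple) (hX0 : 0 < X.dim) :
    {ε : X.endAlgebra | IsIdempotentElem ε}.ncard = 2 := by
  have hinj := endAlgebra.of_injective_of_isIsogeny_zsmul_id (isIsogeny_zsmul_id_holds X)
  have h01 : (0 : X.endAlgebra) ≠ 1 := fun h ↦ id_ne_zero_of_dim_pos hX0 (by
    have h' : End.of (𝟙 X) = 0 := hinj (by rw [map_zero]; exact (map_one (endAlgebra.of X)).trans h.symm)
    exact h')
  have hset : {ε : X.endAlgebra | IsIdempotentElem ε} = {0, 1} := by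
    refine Set.ext fun ε ↦ ⟨fun hε ↦ ?_, ?_⟩
    · by_cases h0 : ε = 0
      · exact Or.inl h0
      · obtain ⟨y, hy, -⟩ := Literature.AlgebraicGeometry.ComplexMultiplication.endAlgebra_exists_inv_of_isSimple hX ε h0
        refine Or.inr ?_
        change ε = 1
        calc ε = ε * (ε * y) := by rw [hy, mul_one]
          _ = ε * ε * y := (mul_assoc _ _ _).symm
          _ = 1 := by rw [hε.eq, hy]
    · rintro (h | h)
      · rw [h]; exact IsIdempotentElem.zero
      · rw [show ε = 1 from h]; exact IsIdempotentElem.one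
  rw [hset, Set.ncard_pair h01]

end AnyField

/-! ## §2 Over a perfect field: finitely many abelian subvarieties ⟺ finitely many idempotents ⟺ all idempotents central -/

section Perfect

variable [PerfectField K] {Q : Type} [Fintype Q] {B : Q → Motives.AbelianVariety K} {n : Q → ℕ} {X : Motives.AbelianVariety K}
  {Y : Q → Motives.AbelianVariety K}

/-- **EVERY IDEMPOTENT OF `End⁰ X` IS CENTRAL IFF `X` HAS FINITELY MANY ABELIAN SUBVARIETIES** (perfect field).
[cite: MumfordAV1970, §19 Cor. 1–2 of Thm. 1 (pp. 173–174)] [cite: Lam2001FirstCourse, §12 Ex. 12.7 (PDF p. 206)]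
[cite: Zarhin2008HomomorphismsFiniteFields, Thm. 3.2 (p. 7)] -/
theorem forall_isIdempotentElem_endAlgebra_comm_iff_finite_setOf_range_subvariety (X : Motives.AbelianVariety K) :
    (∀ ε : X.endAlgebra, IsIdempotentElem ε → ∀ x, ε * x = x * ε) ↔
      {R : Set X.X.left | ∃ (Z : Motives.AbelianVariety K) (j : Z ⟶ X),
        IsClosedImmersion (Hom.toSchemeHom j) ∧ R = Set.range (Hom.toSchemeHom j)}.Finite := by
  constructor
  · intro h
    by_contra hinf
    obtain ⟨r, B, n, Y, i, hB, hB0, hni, hi, hY, -, hdesc, -⟩ := exists_isotypicComponents_orthogonal X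
    have h0 : ¬ ∀ q, n q = 0 := fun h0 ↦
      hinf ((finite_setOf_range_subvariety_iff_forall_multiplicity_eq_zero hB hB0 hni hY i hi hdesc).2 h0)
    obtain ⟨q, hq⟩ := not_forall.1 h0
    obtain ⟨ε, x, hε, hne⟩ := exists_isIdempotentElem_endAlgebra_not_comm_of_component i hi hdesc (hY q)
      (k₀ := (⟨0, by omega⟩ : Fin (n q + 1))) (k₁ := (⟨1, by omega⟩ : Fin (n q + 1))) (Fin.ne_of_val_ne (by norm_num)) (hB0 q)
    exact hne (h ε hε x)
  · intro hfin ε hε x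
    haveI := (finite_setOf_range_subvariety_iff_isReduced_endAlgebra X).1 hfin
    exact forall_comm_of_isIdempotentElem_of_isReduced hε x

/-- **`End⁰ X` HAS FINITELY MANY IDEMPOTENTS IFF `X` HAS FINITELY MANY ABELIAN SUBVARIETIES** (perfect field).
[cite: MumfordAV1970, §19 Cor. 1–2 of Thm. 1 (pp. 173–174)] [cite: Lam2001FirstCourse, §22 Prop. (22.1) p. 326]
[cite: Zarhin2008HomomorphismsFiniteFields, Thm. 3.2 (p. 7)] -/
theorem finite_setOf_isIdempotentElem_endAlgebra_iff_finite_setOf_range_subvariety (X : Motives.AbelianVariety K) :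
    {ε : X.endAlgebra | IsIdempotentElem ε}.Finite ↔
      {R : Set X.X.left | ∃ (Z : Motives.AbelianVariety K) (j : Z ⟶ X),
        IsClosedImmersion (Hom.toSchemeHom j) ∧ R = Set.range (Hom.toSchemeHom j)}.Finite := by
  obtain ⟨r, B, n, Y, i, hB, hB0, hni, hi, hY, -, hdesc, -⟩ := exists_isotypicComponents_orthogonal X
  constructor
  · intro hfin
    by_contra hinf
    have h0 : ¬ ∀ q, n q = 0 := fun h0 ↦
      hinf ((finite_setOf_range_subvariety_iff_forall_multiplicity_eq_zero hB hB0 hni hY i hi hdesc).2 h0)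
    obtain ⟨q, hq⟩ := not_forall.1 h0
    exact infinite_setOf_isIdempotentElem_endAlgebra_of_component i hi hdesc (hY q)
      (k₀ := (⟨0, by omega⟩ : Fin (n q + 1))) (k₁ := (⟨1, by omega⟩ : Fin (n q + 1))) (Fin.ne_of_val_ne (by norm_num))
      (hB0 q) hfin
  · intro hfin
    have hcomm := (forall_isIdempotentElem_endAlgebra_comm_iff_finite_setOf_range_subvariety X).2 hfin
    have heq : {ε : X.endAlgebra | IsIdempotentElem ε} = {z : X.endAlgebra | IsIdempotentElem z ∧ ∀ a, z * a = a * z} :=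
      Set.ext fun _ ↦ ⟨fun hz ↦ ⟨hz, hcomm _ hz⟩, fun hz ↦ hz.1⟩
    rw [heq]
    refine Set.finite_of_ncard_ne_zero ?_
    rw [ncard_setOf_central_idempotent_endAlgebra_eq_two_pow hB hB0 hni hY i hi hdesc]
    positivity

/-- `End⁰ X` has finitely many idempotents iff it is reduced (perfect field). [cite: MumfordAV1970, §19 Cor. 2 of Thm. 1 (p. 174)]
[cite: Lam2001FirstCourse, §12 Ex. 12.7 (PDF p. 206)] -/
theorem finite_setOf_isIdempotentElem_endAlgebra_iff_isReduced_endAlgebra (X : Motives.AbelianVariety K) :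
    {ε : X.endAlgebra | IsIdempotentElem ε}.Finite ↔ IsReduced X.endAlgebra := by
  rw [finite_setOf_isIdempotentElem_endAlgebra_iff_finite_setOf_range_subvariety, finite_setOf_range_subvariety_iff_isReduced_endAlgebra]

/-- With isotypic components all of multiplicity one, `End⁰ X` has exactly `2^{#Q}` idempotents (perfect field).
[cite: Lam2001FirstCourse, §22 Prop. (22.1) p. 326] [cite: MumfordAV1970, §19 Cor. 1–2 of Thm. 1 (pp. 173–174)] -/
theorem natCard_setOf_isIdempotentElem_endAlgebra_eq_two_pow (hB : ∀ q, (B q).IsSimple) (hB0 : ∀ q, 0 < (B q).dim)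
    (hni : ∀ q q', q ≠ q' → ¬ IsIsogenous (B q) (B q')) (hY : ∀ q, IsIsogenous (Y q) (⨁ fun _ : Fin (n q + 1) ↦ B q))
    (i : ∀ q, Y q ⟶ X) (hi : ∀ q, IsClosedImmersion (Hom.toSchemeHom (i q))) (hdesc : IsIsogeny (biproduct.desc i))
    (h0 : ∀ q, n q = 0) : Nat.card {ε : X.endAlgebra | IsIdempotentElem ε} = 2 ^ Fintype.card Q := by
  have hfin := (finite_setOf_range_subvariety_iff_forall_multiplicity_eq_zero hB hB0 hni hY i hi hdesc).2 h0
  have hcomm := (forall_isIdempotentElem_endAlgebra_comm_iff_finite_setOf_range_subvariety X).2 hfin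
  have heq : {ε : X.endAlgebra | IsIdempotentElem ε} = {z : X.endAlgebra | IsIdempotentElem z ∧ ∀ a, z * a = a * z} :=
    Set.ext fun _ ↦ ⟨fun hz ↦ ⟨hz, hcomm _ hz⟩, fun hz ↦ hz.1⟩
  rw [Nat.card_coe_set_eq, heq, ncard_setOf_central_idempotent_endAlgebra_eq_two_pow hB hB0 hni hY i hi hdesc]

/-- **AN ABELIAN VARIETY HAS AS MANY ABELIAN SUBVARIETIES AS ITS ENDOMORPHISM ALGEBRA HAS IDEMPOTENTS** (perfect field;
`Nat.card`: both are `2^r`, `r` the number of isotypic components, when `X` is multiplicity-free, and both sets are infinite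
otherwise). [cite: MumfordAV1970, §19 Cor. 1–2 of Thm. 1 (pp. 173–174)] [cite: Lam2001FirstCourse, §22 Prop. (22.1) p. 326]
[cite: Zarhin2008HomomorphismsFiniteFields, Thm. 3.2 (p. 7)] -/
theorem natCard_setOf_isIdempotentElem_endAlgebra_eq_natCard_setOf_range_subvariety (X : Motives.AbelianVariety K) :
    Nat.card {ε : X.endAlgebra | IsIdempotentElem ε} =
      Nat.card {R : Set X.X.left | ∃ (Z : Motives.AbelianVariety K) (j : Z ⟶ X),
        IsClosedImmersion (Hom.toSchemeHom j) ∧ R = Set.range (Hom.toSchemeHom j)} := by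
  by_cases hfin : {R : Set X.X.left | ∃ (Z : Motives.AbelianVariety K) (j : Z ⟶ X),
      IsClosedImmersion (Hom.toSchemeHom j) ∧ R = Set.range (Hom.toSchemeHom j)}.Finite
  · obtain ⟨r, B, n, Y, i, hB, hB0, hni, hi, hY, -, hdesc, -⟩ := exists_isotypicComponents_orthogonal X
    have h0 : ∀ q, n q = 0 := (finite_setOf_range_subvariety_iff_forall_multiplicity_eq_zero hB hB0 hni hY i hi hdesc).1 hfin
    have hYB : ∀ q, IsIsogenous (Y q) (B q) := fun q ↦ by
      have hd : (Y q).dim = (B q).dim := by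
        rw [dim_eq_mul_of_isIsogenous_biproduct_const (hY q), h0 q, zero_add, one_mul]
      exact isIsogenous_of_isIsogenous_biproduct_const_of_dim_le (hY q) (by rw [hd]; exact hB0 q) hd.le
    have hX : IsIsogenous X (⨁ B) := (IsIsogenous.symm' ⟨biproduct.desc i, hdesc⟩).trans (IsIsogenous.biproduct hYB)
    rw [natCard_setOf_range_subvariety_of_isIsogenous_biproduct_simple hB hB0 hni hX,
      natCard_setOf_isIdempotentElem_endAlgebra_eq_two_pow hB hB0 hni hY i hi hdesc h0, Fintype.card_fin]
  · have hinf : {ε : X.endAlgebra | IsIdempotentElem ε}.Infinite := fun h ↦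
      hfin ((finite_setOf_isIdempotentElem_endAlgebra_iff_finite_setOf_range_subvariety X).1 h)
    rw [Set.Infinite.card_eq_zero hinf, Set.Infinite.card_eq_zero hfin]

end Perfect

end AbelianVariety

end Literature.AlgebraicGeometry.HodgeTheory

end
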